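import Summits.QuantumFields.YangMills.Theorems.UnitScaleTiltProp8HalvingGtMatrix
import Summits.QuantumFields.YangMills.Theorems.UnitScaleTiltProp8FlatCubeOperators
import HarnessLib

/-!
# Route `UnitScaleTilt`, crux K1 child «MinimiserStabilityRegPr» (stmt-QuantumFields-19200), registered stub V2′ `stub_halvingStep`
# (skeletons v8 5b4e846794b80374 / v10 `BirthV10`) — **THE E–L JUNCTION FOR THE `∂^{η*}∂^η` ROW OF (165)-A₁** (owner socket (σ-3), 2026-08-28):
# on the residual-Landau slice `R∂*A₁ = 0` the solution `A₁ = −G̃w` of [Balaban1985Variational] (158) has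
# `∂*∂A₁ = −w + Q*(QGQ*)⁻¹QG·w` EXACTLY (print p. 298 «P₀A₀ = A₀, Δ_aA₀ = (Δ + DRD*)A₀», (131) `P₀ = 1 − GQ*(QGQ*)⁻¹Q`, at background 1),
# for the `𝔤`-valued fields of the halving package through the kernel extension of P2's pinned operators and the flat-stencil dictionary —
# i.e. the displayed hypothesis `hEL` of the (165)-A₁ row knit `HalvingA1Row165.row165_of_smallSolution` (★w5-19200 g2) with
# `Mv := 𝔐 = Q*(QGQ*)⁻¹QG = (HQ)ᵀ`; and the exact reduction `Q*(QGQ*)⁻¹·β = ∂*∂H·β + Q*a·β` of `𝔐`'s letter to the text's `∂*∂`-row of `H`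

Cell `ym3-torus` (HUMAN RULING D-0037, YM ladder rung R3 — continuum SU(2) YM₃ on the torus is a RUNG, not the Clay problem), width seat
`ym-ust-19200-w3` gen 3 (D-0149).  `--supports stmt-QuantumFields-19200 --as helper`; def-free, 0 sorry, standard axioms.

THE PRINT ([Balaban1985Variational], CMP **102** (1985); journal page = PDF page + 276).  p. 297: *«The configuration A′₁ satisfies RD*A′₁ = 0, hence the
above equation can be written as ⟨δA′, J⟩ + ⟨δA′, Δ_aA′₁⟩ + ⟨δA′, (δ/δA′)V(A′₁)⟩ = 0, (128) where Δ_a = Δ + DRD* + Q*aQ»*; p. 298: *«the projection is given by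
P₀ = I − GQ*(QGQ*)⁻¹Q. (131) … By the definition of H₀B we have QA₀ = 0, hence P₀A₀ = A₀, Δ_aA₀ = (Δ + DRD*)A₀ … A₀ = −GP₀*J + … (133) … the right-hand
side of (133) can be estimated by O(1)C₁B₃ε₁(Lʲη)⁻³ on Ωⱼ»*; p. 299: *«Above we have used the equality RD*H = 0»*; p. 302: *«A₁ + G̃((δ/δA′)V)(A₁ + HB) = 0. (158)
… all the operators in this section are taken without any external gauge field configuration»*; p. 304 (165): *«|A|, |∇^ηA|, |d^{η*}d^ηA|, |Δ^ηA| < …»*.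
At background 1 the operators are [Balaban1984PropagatorsII] (2.19) `Δ_a = ∂*∂ + ∂R∂* + Q*aQ`, (2.22) `G = Δ_a⁻¹`, (2.35) `H = GQ*(QGQ*)⁻¹`, `G̃ = G − HQG`,
kernel-checked for EVERY nested family by lit-balaban p21/r03 (`B6SectAOperatorsV1`, `B6SectAVectorModelV1`) with the exact algebra of `FlatCubeOperators` (p1 g15):
`R∂*H = 0` (Faddeev–Popov (2.34)), `QH = 1`, `Δ_aH = Q*(QGQ*)⁻¹`, `QG̃ = 0`, `Δ_aG̃ = 1 − Q*(QGQ*)⁻¹QG` (= `P₀ᵀ`).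

WHAT THIS FILE PROVES (no definition, no sorry):
* §1 (model level, every `D : Domains P`, lattice factor `c ≠ 0`, weights `w > 0`):
  `dcsE_dcE_eq_deltaAE_of_slice` (`R∂*x = 0 ∧ Qx = 0 ⇒ ∂*∂x = Δ_ax`), **`dcsE_dcE_eq_of_slice_of_eq_neg_Gt`** (`R∂*x = 0 ∧ x = −G̃φ ⇒ ∂*∂x = −φ + Q*(QGQ*)⁻¹QGφ`
  — THE Δ-ROW ON THE SLICE), **`QsE_EE_eq`** (`Q*(QGQ*)⁻¹β = ∂*∂(Hβ) + Q*aβ` — the multiplier operator through the `∂*∂`-row of `H`),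
  `RE_dsE_add_hOp`∕`RE_dsE_sub_hOp` (the slice is blind to `H`-images: transport of (153) through `A = A′ − HD(A′)`, `A₁ = A′ − HB`).
* §2 (readings): `linear_kernel` (an `ℝ`-linear reading of a kernel sum `Σ_i (Te_i)(k)·B(i)` is `T` of the read datum), `eq_of_forall_reFunctional`
  (a vector of a complex normed space is determined by the readings `r·Re(u·f(·))`).
* §3 (the T³ carrier, EVERY nested family `D : Domains (F.P K)`, P2's pinned letters `IsFlatGt`∕`flatH`, `η = L^{−(K−n)}`):
  **`flatStencil_eq_of_slice`** — for `𝔤`-valued `A₁`, `w` with `A₁ + 𝒢w = 0` (`𝒢` the kernel extension of a pinned `G̃`), the slice `R∂*(φ∘A₁) = 0` for every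
  `ℝ`-linear reading `φ`, and `ℳ` the kernel extension of the pinned plain-function `𝔐 = Q*(QGQ*)⁻¹QG`:
  `pdiv η 1 (plaqCovDeriv η 1 (pull A₁ 0)) μ z = −w⟨0+z, μ⟩ + ℳ⟨0+z, μ⟩` at EVERY `(z, μ)` — LITERALLY the body of `hEL`; `exists_Mop` (the pinned `𝔐` as a
  plain-function linear map); **`slice_of_decomp`** (the slice for `A₁` from the slice for the chart field `A = A₁ + 𝔄 − R` when `𝔄`, `R` are kernel images of `flatH`);
  `slice_of_inGaugeTest` (the matrix form of (2.12): `Σ_s (Δμ)(s)·(∂*A₁)(s) = 0` for all `μ ∈ N(Q′)` gives the slice for every reading).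
HONEST SCOPE.  Exact finite-dimensional algebra and bookkeeping; NO estimate.  The slice (153) `R d^{η*}A = 0` is [Balaban1985RegularSpaces] Thm 2 on the cube
sequence (P1's output) and is a HYPOTHESIS here (print keeps it too: `R∂*G̃ ≠ 0` in general, so it is not a consequence of (158)); the sup letter of `𝔐` on the
layer (print p. 298, from [5] (3.133)) is NOT proved here — §1 `QsE_EE_eq` reduces it to the text's `∂*∂`-row of `H` (`FlatCubeOpsText.HDecayLetterD`) and a size
of the multiplier datum.  NOT a claim about the crux, the rung, or the mass gap.

References: T. Bałaban, CMP **102** (1985) 277–309 [Balaban1985Variational] (127)–(133) pp.297–298, p.299, (143) p.300, (153) p.301, (158) p.302, (165) p.304;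
CMP **96** (1984) 223–250 [Balaban1984PropagatorsII] (2.12) p.225, (2.19)–(2.22) p.226, (2.34)–(2.35) p.228.
-/

set_option autoImplicit false

noncomputable section

open scoped BigOperators InnerProductSpace Matrix.Norms.L2Operator

namespace Summit.QuantumFields.YangMills.Theorems.HalvingELJunction

open Literature.MathematicalPhysics.QuantumFieldTheory.Balaban1983to89
open Literature.MathematicalPhysics.QuantumFieldTheory.BalabanImbrieJaffe1984to88.BIJ85AxialPropagator411 (BondSpace PlaqSpace)
open B6SectADomainsV1 (Domains)
open B6SectAOperatorsV1 (BondIdx BondIdxSpace ScalarSpace QE QsE QpE RE dsE dcE dcsE dE aE lapE inner_eq_sum mem_ker_QpE_iff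
  RE_eq_zero_iff lapE_apply dsE_apply)
open B6SectAVectorModelV1 (deltaAE GE EE deltaAE_def)
open B6SectA (hOp)
open FlatCubeOperators (QE_hOp RE_dsE_hOp deltaAE_hOp QE_Gt deltaAE_Gt)
open B8Eq143PlaqExpansion (pdiv)
open B8Eq146AExpansion (plaqCovDeriv)
open B10Eq27TorusAxialLog (pull transl)
open LatticeFieldCalculus (laplace diverg)
open T3ContinuumYM3Torus (T3Family)
open FlatCubeOpsText (IsFlatGt)
open FlatOpsLettersAssembly (flatH)
open HalvingQuarterMatrix (re_pdiv_plaqCovDeriv_pull)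

/-! ## §1 The Δ-row on the slice and the multiplier operator (model level, every nested family) -/

section Model

variable {P : Params} (D : Domains P) {c : ℝ} (hc : c ≠ 0) {w : BondIdx D → ℝ} (hw : ∀ i, 0 < w i)

omit hc hw in
/-- **ON THE SLICE `R∂*x = 0` WITH `Qx = 0`: `∂*∂x = Δ_ax`** ((2.19): the `∂R∂*` and `Q*aQ` terms drop; print p. 298 «P₀A₀ = A₀, Δ_aA₀ = (Δ + DRD*)A₀»
with `RD*A₀ = 0`). [cite: Balaban1984PropagatorsII, (2.19) p.226; Balaban1985Variational, (128) p.297, p.298] -/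
theorem dcsE_dcE_eq_deltaAE_of_slice (w : BondIdx D → ℝ) {x : BondSpace P} (hx : RE D c (dsE c x) = 0) (hQ : QE D x = 0) :
    dcsE c (dcE c x) = deltaAE D c w x := by
  rw [deltaAE_def]
  simp only [LinearMap.add_apply, LinearMap.coe_comp, Function.comp_apply, hx, hQ, map_zero, add_zero]

/-- **THE Δ-ROW ON THE SLICE**: if `R∂*x = 0` and `x = −G̃φ` (`G̃ = G − HQG`, (158)), then `∂*∂x = −φ + Q*(QGQ*)⁻¹QGφ` — `Qx = 0` is automatic («Q𝔊 = 0»)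
and `Δ_aG̃ = 1 − Q*(QGQ*)⁻¹QG = P₀ᵀ` ((131), (133)). [cite: Balaban1985Variational, (131) p.298, (133) p.298, (158) p.302; Balaban1984PropagatorsII, (2.19) p.226] -/
theorem dcsE_dcE_eq_of_slice_of_eq_neg_Gt {x : BondSpace P} (φ : BondSpace P) (hx : RE D c (dsE c x) = 0)
    (hsol : x = -((GE D hc hw - hOp (GE D hc hw) (QsE D) (EE D hc hw) ∘ₗ QE D ∘ₗ GE D hc hw) φ)) :
    dcsE c (dcE c x) = -φ + QsE D (EE D hc hw (QE D (GE D hc hw φ))) := by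
  have hQ : QE D x = 0 := by rw [hsol, map_neg, QE_Gt, neg_zero]
  rw [dcsE_dcE_eq_deltaAE_of_slice D w hx hQ, hsol, map_neg, deltaAE_Gt, neg_sub, sub_eq_neg_add]

/-- **THE MULTIPLIER OPERATOR THROUGH THE `∂*∂`-ROW OF `H`**: `Q*(QGQ*)⁻¹β = ∂*∂(Hβ) + Q*aβ` — from `Δ_aH = Q*(QGQ*)⁻¹` (`Δ_aG = 1`), the Landau condition
`R∂*H = 0` (Faddeev–Popov (2.34)) and `QH = 1` ((45)); print's route to «RHS of (133) = O(1)…» through the second-order rows of `H` ((130), (137)–(140)).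
[cite: Balaban1985Variational, (130) p.298, (137)-(140) pp.298-299; Balaban1984PropagatorsII, (2.34)-(2.35) p.228] -/
theorem QsE_EE_eq (β : BondIdxSpace D) :
    QsE D (EE D hc hw β) = dcsE c (dcE c (hOp (GE D hc hw) (QsE D) (EE D hc hw) β)) + QsE D (aE D w β) := by
  have h1 := deltaAE_hOp D hc hw β
  rw [deltaAE_def] at h1
  simp only [LinearMap.add_apply, LinearMap.coe_comp, Function.comp_apply, RE_dsE_hOp, map_zero, add_zero, QE_hOp] at h1
  exact h1.symm

/-- specialisation: `Q*(QGQ*)⁻¹QGφ = ∂*∂(H(QGφ)) + Q*a(QGφ)` — the `𝔐` of the Δ-row. [cite: Balaban1985Variational, (131)-(133) p.298] -/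
theorem QsE_EE_QE_GE_eq (φ : BondSpace P) :
    QsE D (EE D hc hw (QE D (GE D hc hw φ))) =
      dcsE c (dcE c (hOp (GE D hc hw) (QsE D) (EE D hc hw) (QE D (GE D hc hw φ)))) + QsE D (aE D w (QE D (GE D hc hw φ))) :=
  QsE_EE_eq D hc hw _

/-- **THE SLICE IS BLIND TO `H`-IMAGES**: `R∂*(x + Hβ) = R∂*x` (`R∂*H = 0`, p. 299 «we have used the equality RD*H = 0») — transport of (153) through
`A = A′ − HD(A′)` and `A₁ = A′ − HB`. [cite: Balaban1985Variational, p.299, (153) p.301, (157)-(159) pp.302-303] -/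
theorem RE_dsE_add_hOp (x : BondSpace P) (β : BondIdxSpace D) :
    RE D c (dsE c (x + hOp (GE D hc hw) (QsE D) (EE D hc hw) β)) = RE D c (dsE c x) := by
  rw [map_add, map_add, RE_dsE_hOp, add_zero]

/-- `R∂*(x − Hβ) = R∂*x`. [cite: Balaban1985Variational, p.299, (157)-(159) pp.302-303] -/
theorem RE_dsE_sub_hOp (x : BondSpace P) (β : BondIdxSpace D) :
    RE D c (dsE c (x - hOp (GE D hc hw) (QsE D) (EE D hc hw) β)) = RE D c (dsE c x) := by
  rw [map_sub, map_sub, RE_dsE_hOp, sub_zero]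

end Model

/-! ## §2 Readings: linear readings of kernel sums; a vector is determined by its readings -/

section Readings

variable {ι κ : Type*} [Fintype ι] [DecidableEq ι]

/-- **`φ(𝔄(k)) = T(φ ∘ B)(k)`** for the kernel extension `𝔄(k) = Σ_i (Te_i)(k)·B(i)` of a real linear `T` to matrix-valued data and ANY `ℝ`-linear reading `φ`
(linearity of `T` on `X = Σ_i X(i)e_i`). [cite: Balaban1985Variational, (158) p.302] -/
theorem linear_kernel (T : (ι → ℝ) →ₗ[ℝ] (κ → ℝ)) {B : ι → Matrix (Fin 2) (Fin 2) ℂ} {𝔄 : κ → Matrix (Fin 2) (Fin 2) ℂ}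
    (h𝔄 : ∀ k, 𝔄 k = ∑ i, T (Pi.single i 1) k • B i) (φ : Matrix (Fin 2) (Fin 2) ℂ →ₗ[ℝ] ℝ) (k : κ) :
    φ (𝔄 k) = T (fun i => φ (B i)) k := by
  have hX : (fun i => φ (B i)) = ∑ i, (φ (B i)) • (Pi.single i (1 : ℝ) : ι → ℝ) := by
    funext i'
    rw [Finset.sum_apply, Finset.sum_eq_single i' (fun i _ hi => by simp [Ne.symm hi]) (fun h => absurd (Finset.mem_univ _) h)]
    simp
  rw [hX, map_sum, Finset.sum_apply, h𝔄 k, map_sum]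
  refine Finset.sum_congr rfl fun i _ => ?_
  simp only [LinearMap.map_smul, Pi.smul_apply, smul_eq_mul]
  rw [mul_comm]

omit [Fintype ι] [DecidableEq ι] in
/-- **A VECTOR IS DETERMINED BY ITS READINGS** `r·Re(u·f(·))` (`f` a continuous `ℂ`-linear functional): Hahn–Banach separation plus `Re(z)`, `Re(−iz) = Im(z)`.
[folklore] -/
theorem eq_of_forall_reFunctional {E : Type*} [NormedAddCommGroup E] [NormedSpace ℂ E] {x y : E}
    (h : ∀ (f : StrongDual ℂ E) (u : ℂ) (r : ℝ), r * (u * f x).re = r * (u * f y).re) : x = y := by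
  refine (SeparatingDual.eq_iff_forall_dual_eq (R := ℂ)).2 fun f => ?_
  apply Complex.ext
  · simpa using h f 1 1
  · have := h f (-Complex.I) 1
    simpa using this

end Readings

/-! ## §3 The junction at the T³ carrier: the `hEL` identity for the `𝔤`-valued fields of the package -/

section Carrier

variable {F : T3Family} {n K : ℕ}

/-- **THE PINNED MULTIPLIER OPERATOR `𝔐 = Q*(QGQ*)⁻¹QG` AS A PLAIN-FUNCTION LINEAR MAP** (lattice factor `L^{K−n} = η⁻¹`, weights `a ≡ 1` as in `IsFlatGt`;
`(HQ)ᵀ` — canonical).  For the consumer's `obtain`. [cite: Balaban1985Variational, (131) p.298; Balaban1984PropagatorsII, (2.35) p.228] -/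
theorem exists_Mop (D : Domains (F.P K)) :
    ∃ Mop : (PBond (F.P K) 0 → ℝ) →ₗ[ℝ] (PBond (F.P K) 0 → ℝ), ∀ (f : PBond (F.P K) 0 → ℝ) (b : PBond (F.P K) 0),
      Mop f b = QsE D (EE D (c := (F.L : ℝ) ^ (K - n)) (pow_ne_zero _ (Nat.cast_ne_zero.2 (F.P K).L_pos.ne')) (w := fun _ => (1 : ℝ))
        (fun _ => one_pos) (QE D (GE D (c := (F.L : ℝ) ^ (K - n)) (pow_ne_zero _ (Nat.cast_ne_zero.2 (F.P K).L_pos.ne')) (w := fun _ => (1 : ℝ))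
        (fun _ => one_pos) (WithLp.toLp 2 f)))) b :=
  ⟨(WithLp.linearEquiv 2 ℝ (PBond (F.P K) 0 → ℝ)).toLinearMap ∘ₗ
      (QsE D ∘ₗ EE D (c := (F.L : ℝ) ^ (K - n)) (pow_ne_zero _ (Nat.cast_ne_zero.2 (F.P K).L_pos.ne')) (w := fun _ => (1 : ℝ)) (fun _ => one_pos) ∘ₗ
        QE D ∘ₗ GE D (c := (F.L : ℝ) ^ (K - n)) (pow_ne_zero _ (Nat.cast_ne_zero.2 (F.P K).L_pos.ne')) (w := fun _ => (1 : ℝ)) (fun _ => one_pos)) ∘ₗ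
      (WithLp.linearEquiv 2 ℝ (PBond (F.P K) 0 → ℝ)).symm.toLinearMap,
    fun _ _ => rfl⟩

/-- **THE E–L JUNCTION — THE `hEL` IDENTITY FOR THE `𝔤`-VALUED FIELDS OF THE HALVING PACKAGE.**  At the T³ carrier, for EVERY nested family `D` and a plain-function
`G̃` pinned by P2's `IsFlatGt`: if `A₁ + 𝒢 = 0` with `𝒢(b) = Σ_{b′} (G̃e_{b′})(b)·w(b′)` ((158) for the matrix current `w = W(A₁ + HB)`), if EVERY `ℝ`-linear reading of
`A₁` lies on the slice `R∂*(φ∘A₁) = 0` ((153), transported — `slice_of_decomp`), and `ℳ(b) = Σ_{b′} (𝔐e_{b′})(b)·w(b′)` for the pinned `𝔐 = Q*(QGQ*)⁻¹QG`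
(`exists_Mop`), then at EVERY `(z, μ)`:  `pdiv η 1 (plaqCovDeriv η 1 (pull A₁ 0)) μ z = −w⟨0+z, μ⟩ + ℳ⟨0+z, μ⟩`, `η = L^{−(K−n)}` — the flat `∂^{η*}∂^ηA₁` IS
`−w + 𝔐w` read in F2's letters (the body of `HalvingA1Row165.row165_of_smallSolution`'s `hEL` with `W(A₁+𝔄) ↦ w`, `Mv W ↦ ℳ`).
[cite: Balaban1985Variational, (128) p.297, (131)-(133) p.298, (153) p.301, (158) p.302, (165) p.304; Balaban1984PropagatorsII, (2.19) p.226, (2.35) p.228] -/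
theorem flatStencil_eq_of_slice (D : Domains (F.P K)) {Gt : (PBond (F.P K) 0 → ℝ) →ₗ[ℝ] (PBond (F.P K) 0 → ℝ)} (hGt : IsFlatGt F n K D Gt)
    (Mop : (PBond (F.P K) 0 → ℝ) →ₗ[ℝ] (PBond (F.P K) 0 → ℝ))
    (hMop : ∀ (f : PBond (F.P K) 0 → ℝ) (b : PBond (F.P K) 0),
      Mop f b = QsE D (EE D (c := (F.L : ℝ) ^ (K - n)) (pow_ne_zero _ (Nat.cast_ne_zero.2 (F.P K).L_pos.ne')) (w := fun _ => (1 : ℝ))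
        (fun _ => one_pos) (QE D (GE D (c := (F.L : ℝ) ^ (K - n)) (pow_ne_zero _ (Nat.cast_ne_zero.2 (F.P K).L_pos.ne')) (w := fun _ => (1 : ℝ))
        (fun _ => one_pos) (WithLp.toLp 2 f)))) b)
    {A₁ w 𝒢 ℳ : PBond (F.P K) 0 → Matrix (Fin 2) (Fin 2) ℂ}
    (h𝒢 : ∀ b, 𝒢 b = ∑ b', Gt (Pi.single b' 1) b • w b') (hsol : A₁ + 𝒢 = 0)
    (hslice : ∀ φ : Matrix (Fin 2) (Fin 2) ℂ →ₗ[ℝ] ℝ,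
      RE D ((F.L : ℝ) ^ (K - n)) (dsE ((F.L : ℝ) ^ (K - n)) (WithLp.toLp 2 (fun b => φ (A₁ b)))) = 0)
    (hℳ : ∀ b, ℳ b = ∑ b', Mop (Pi.single b' 1) b • w b') :
    ∀ (z : B7Prop1Explicit.Site (F.P K).d) (μ : Fin (F.P K).d),
      pdiv (((F.L : ℝ)⁻¹) ^ (K - n)) (1 : B7Prop1Explicit.Site (F.P K).d → Fin (F.P K).d → (Matrix (Fin 2) (Fin 2) ℂ)ˣ)
          (plaqCovDeriv (((F.L : ℝ)⁻¹) ^ (K - n)) (1 : B7Prop1Explicit.Site (F.P K).d → Fin (F.P K).d → (Matrix (Fin 2) (Fin 2) ℂ)ˣ)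
            (pull A₁ 0)) μ z =
        -(w ⟨transl 0 z, μ⟩) + ℳ ⟨transl 0 z, μ⟩ := by
  intro z μ
  have hc : ((F.L : ℝ) ^ (K - n)) ≠ 0 := pow_ne_zero _ (Nat.cast_ne_zero.2 (F.P K).L_pos.ne')
  have hη : ((((F.L : ℝ)⁻¹) ^ (K - n))⁻¹ : ℝ) = (F.L : ℝ) ^ (K - n) := by rw [inv_pow, inv_inv]
  -- `A₁ = −𝒢` pointwise
  have hA₁ : ∀ b, A₁ b = -(𝒢 b) := fun b => by
    have h := congrFun hsol b
    rw [Pi.add_apply, Pi.zero_apply] at h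
    exact eq_neg_of_add_eq_zero_left h
  refine eq_of_forall_reFunctional fun fd u r => ?_
  -- the reading `M ↦ r·Re(u·fd(M))` as an `ℝ`-linear functional
  let φ : Matrix (Fin 2) (Fin 2) ℂ →ₗ[ℝ] ℝ :=
    { toFun := fun M => r * (u * fd M).re
      map_add' := fun M N => by simp only [map_add, mul_add, Complex.add_re]
      map_smul' := fun s M => by
        rw [ContinuousLinearMap.map_smul_of_tower, Complex.real_smul, mul_left_comm u, Complex.re_ofReal_mul, RingHom.id_apply, smul_eq_mul]
        ring }
  have hφ : ∀ M, φ M = r * (u * fd M).re := fun _ => rfl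
  -- the read field `x = φ ∘ A₁` lies on the slice and solves `x = −G̃(φ ∘ w)`
  have hx : RE D ((F.L : ℝ) ^ (K - n)) (dsE ((F.L : ℝ) ^ (K - n)) (WithLp.toLp 2 (fun b => φ (A₁ b)))) = 0 := hslice φ
  have hxeq : WithLp.toLp 2 (fun b => φ (A₁ b)) =
      -((GE D hc (w := fun _ => (1 : ℝ)) (fun _ => one_pos) -
          hOp (GE D hc (w := fun _ => (1 : ℝ)) (fun _ => one_pos)) (QsE D) (EE D hc (w := fun _ => (1 : ℝ)) (fun _ => one_pos)) ∘ₗ QE D ∘ₗ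
            GE D hc (w := fun _ => (1 : ℝ)) (fun _ => one_pos)) (WithLp.toLp 2 (fun b' => φ (w b')))) := by
    ext b
    rw [PiLp.neg_apply]
    show φ (A₁ b) = _
    rw [hA₁ b, map_neg, linear_kernel Gt h𝒢 φ b]
    exact congrArg Neg.neg (hGt (fun b' => φ (w b')) b)
  have key := dcsE_dcE_eq_of_slice_of_eq_neg_Gt D hc (fun _ => one_pos) (WithLp.toLp 2 (fun b' => φ (w b'))) hx hxeq
  have keyb := congrArg (fun v : BondSpace (F.P K) => v ⟨transl 0 z, μ⟩) key
  simp only [PiLp.add_apply, PiLp.neg_apply] at keyb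
  -- left side: the flat-stencil dictionary; right side: the readings of `w` and `ℳ`
  rw [re_pdiv_plaqCovDeriv_pull _ fd u r A₁ μ z, hη]
  show dcsE ((F.L : ℝ) ^ (K - n)) (dcE ((F.L : ℝ) ^ (K - n)) (WithLp.toLp 2 (fun b => φ (A₁ b)))) ⟨transl 0 z, μ⟩ = _
  rw [keyb, map_add, map_neg, mul_add, mul_neg, Complex.add_re, Complex.neg_re, mul_add, mul_neg, ← hφ, ← hφ,
    linear_kernel Mop hℳ φ ⟨transl 0 z, μ⟩, hMop]

/-- **TRANSPORT OF THE SLICE THROUGH THE DECOMPOSITION (159)**: if the chart field `A = A₁ + 𝔄 − R` has every reading on the slice (`R∂*(φ∘A) = 0`, [B8] Thm 2's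
(153) `Rd^{η*}A = 0` read in P2's letters) and `𝔄 = HB`, `R = HD(A′)` are kernel images of the pinned `flatH`, then every reading of `A₁` is on the slice
(`R∂*H = 0`). [cite: Balaban1985Variational, p.299, (153) p.301, (157)-(159) pp.302-303] -/
theorem slice_of_decomp (D : Domains (F.P K)) {A A₁ 𝔄 R : PBond (F.P K) 0 → Matrix (Fin 2) (Fin 2) ℂ}
    {B B' : BondIdx D → Matrix (Fin 2) (Fin 2) ℂ}
    (hdec : A = A₁ + 𝔄 - R) (h𝔄 : ∀ b, 𝔄 b = ∑ c, flatH F n K D (Pi.single c 1) b • B c)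
    (hR : ∀ b, R b = ∑ c, flatH F n K D (Pi.single c 1) b • B' c)
    (hA : ∀ φ : Matrix (Fin 2) (Fin 2) ℂ →ₗ[ℝ] ℝ,
      RE D ((F.L : ℝ) ^ (K - n)) (dsE ((F.L : ℝ) ^ (K - n)) (WithLp.toLp 2 (fun b => φ (A b)))) = 0) :
    ∀ φ : Matrix (Fin 2) (Fin 2) ℂ →ₗ[ℝ] ℝ,
      RE D ((F.L : ℝ) ^ (K - n)) (dsE ((F.L : ℝ) ^ (K - n)) (WithLp.toLp 2 (fun b => φ (A₁ b)))) = 0 := by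
  intro φ
  have hc : ((F.L : ℝ) ^ (K - n)) ≠ 0 := pow_ne_zero _ (Nat.cast_ne_zero.2 (F.P K).L_pos.ne')
  -- the readings of the two `H`-images are `H` of the read data
  have h𝔄' : WithLp.toLp 2 (fun b => φ (𝔄 b)) =
      hOp (GE D hc (w := fun _ => (1 : ℝ)) (fun _ => one_pos)) (QsE D) (EE D hc (w := fun _ => (1 : ℝ)) (fun _ => one_pos))
        (WithLp.toLp 2 (fun c => φ (B c))) := by
    ext b
    show φ (𝔄 b) = _
    rw [linear_kernel (flatH F n K D) h𝔄 φ b]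
    rfl
  have hR' : WithLp.toLp 2 (fun b => φ (R b)) =
      hOp (GE D hc (w := fun _ => (1 : ℝ)) (fun _ => one_pos)) (QsE D) (EE D hc (w := fun _ => (1 : ℝ)) (fun _ => one_pos))
        (WithLp.toLp 2 (fun c => φ (B' c))) := by
    ext b
    show φ (R b) = _
    rw [linear_kernel (flatH F n K D) hR φ b]
    rfl
  have hA₁ : WithLp.toLp 2 (fun b => φ (A₁ b)) =
      WithLp.toLp 2 (fun b => φ (A b)) - WithLp.toLp 2 (fun b => φ (𝔄 b)) + WithLp.toLp 2 (fun b => φ (R b)) := by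
    ext b
    simp only [PiLp.add_apply, PiLp.sub_apply]
    show φ (A₁ b) = φ (A b) - φ (𝔄 b) + φ (R b)
    rw [hdec, Pi.sub_apply, Pi.add_apply, map_sub, map_add]
    ring
  rw [hA₁, h𝔄', hR', map_add, map_sub, map_add, map_sub, hA φ, RE_dsE_hOp, RE_dsE_hOp, sub_zero, zero_add]

/-- **THE MATRIX FORM OF (2.12) GIVES THE SLICE FOR EVERY READING**: if `Σ_s (Δμ)(s)·(∂*A₁)(s) = 0` (an `M₂(ℂ)`-valued sum; `∂*` = `diverg`, `Δ` = `laplace`, lattice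
factor `L^{K−n}`) for every `μ ∈ N(Q′)` (`Domains.InGauge`), then `R∂*(φ∘A₁) = 0` for every `ℝ`-linear reading `φ`.
[cite: Balaban1984PropagatorsII, (2.9) p.224, (2.12) p.225; Balaban1985Variational, (153) p.301] -/
theorem slice_of_inGaugeTest (D : Domains (F.P K)) {A₁ : PBond (F.P K) 0 → Matrix (Fin 2) (Fin 2) ℂ}
    (htest : ∀ μ : Site (F.P K) 0 → ℝ, D.InGauge μ →
      ∑ s, laplace ((F.L : ℝ) ^ (K - n)) μ s • diverg ((F.L : ℝ) ^ (K - n)) A₁ s = 0) :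
    ∀ φ : Matrix (Fin 2) (Fin 2) ℂ →ₗ[ℝ] ℝ,
      RE D ((F.L : ℝ) ^ (K - n)) (dsE ((F.L : ℝ) ^ (K - n)) (WithLp.toLp 2 (fun b => φ (A₁ b)))) = 0 := by
  intro φ
  rw [RE_eq_zero_iff]
  intro ν hν
  have hdiv : ∀ s, diverg ((F.L : ℝ) ^ (K - n)) (fun b => φ (A₁ b)) s = φ (diverg ((F.L : ℝ) ^ (K - n)) A₁ s) := by
    intro s
    simp only [diverg, map_sum, LinearMap.map_smul, map_sub, smul_eq_mul]
  rw [inner_eq_sum]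
  have h := congrArg φ (htest (WithLp.ofLp ν) ((mem_ker_QpE_iff D ν).1 hν))
  rw [map_sum, map_zero] at h
  rw [← h]
  refine Finset.sum_congr rfl fun s _ => ?_
  rw [lapE_apply, dsE_apply, LinearMap.map_smul, smul_eq_mul]
  congr 1
  exact hdiv s

end Carrier

end Summit.QuantumFields.YangMills.Theorems.HalvingELJunction

end
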